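import Mathlib
import Literature.Analysis.FluidPDE.SuitableWeakRescaling
import Literature.Analysis.FluidPDE.LocalTypeIScaling
import Literature.Analysis.FluidPDE.LocalTypeIProofs
import HarnessLib

/-!
# The Euler zoom of the unit-cylinder scenario: suitability with viscosity `λ^ρ`, the three uniform bounds on every
# `Q(0, a)`, `λa ≤ 1`, and the floor at scale `λ` (support item `EulerZoomLiouville.SereginZoomReduction` = stmt-19834)

Route `EulerZoomLiouville` (NavierStokesRegularity), support item Z = Seregin's Euler-zoom theorem (Seregin 2026 Thm 3.1
= Seregin 2023 Prop 1.2 at `(s,l,κ) = (3,3,2)`, `f(r) = r^ρ`; Seregin 2023 §2 p. 7: "`v^{λ,α}(y,τ) = λ^α v(x,t)`,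
`x = λy`, `t = λ^{α+1}τ`", `α = 1 + ρ`).  For a suitable weak Navier–Stokes solution `(v,q)` (`ν = 1`) in `Q(0,1)`
with weak gradient `G` and the power gauge `r^{2ρ} A(r) + r^ρ E(r) + r^{2ρ} D(r) ≤ M` on `]0,1]`, the EULER ZOOM
`v_λ = λ^{1+ρ} v ∘ Φ`, `q_λ = λ^{2+2ρ} q ∘ Φ`, `G_λ = λ^{2+ρ} G ∘ Φ`, `Φ(s,y) = (λ^{2+ρ}s, λy)` (tree `stRescale` with
`α = λ^{1+ρ}`, `γ = λ`, `β = αγ`) is a suitable weak solution with viscosity `λ^ρ` on `Q(0,a)`, `λa ≤ 1`, with weak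
gradient `G_λ` (`eulerZoom_isSuitableWeakSolutionOn`, `eulerZoom_hasWeakSpatialGradientOn`), obeys the UNIFORM
unnormalised bounds `∫_{B(0,a)}|v_λ(t)|² ≤ M a^{1−2ρ}` (every `t ∈ ]−a²,0[`), `∫_{Q(0,a)}|G_λ|² ≤ M a^{1−ρ}`,
`∫_{Q(0,a)}|q_λ|^{3/2} ≤ M a^{2−2ρ}` (`eulerZoom_slice_energy_le`, `eulerZoom_grad_le`, `eulerZoom_pressure_le`: the power
gauge is Euler-zoom covariant), and `∫_{Q(0,1)} |v_λ|³ = λ^{2ρ−2} ∫_{]−λ^{2+ρ},0[ × B(0,λ)} |v|³` (`eulerZoom_cube_eq`, the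
floor (3.1)).  WHAT THIS IS NOT: not NS regularity, not the crux; bookkeeping `--supports` stmt-19834. [folklore]
-/

noncomputable section

set_option linter.dupNamespace false

open MeasureTheory TopologicalSpace Set Function Filter Topology Metric
open scoped NNReal ENNReal InnerProductSpace RealInnerProductSpace

namespace Summit.NavierStokesRegularity.NavierStokesRegularity.Theorems.SereginZoomReduction

open Literature.Analysis Literature.Analysis.FluidPDE

section EulerZoom

variable {ρ lam a : ℝ}

/-- `λ^{2+ρ} = λ^{1+ρ} · λ` (`λ > 0`). [folklore] -/
theorem rpow_two_add_eq (hlam : 0 < lam) (ρ : ℝ) : lam ^ (2 + ρ) = lam ^ (1 + ρ) * lam := by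
  rw [show (2 : ℝ) + ρ = (1 + ρ) + 1 by ring, Real.rpow_add hlam, Real.rpow_one]

/-- Scaling constant of the energy: `(λ³)⁻¹ (λ^{1+ρ})² (λa)^{1−2ρ} = a^{1−2ρ}`. [folklore] -/
theorem zoomConst_energy (hlam : 0 < lam) (ha : 0 ≤ a) (ρ : ℝ) :
    (lam ^ 3)⁻¹ * ((lam ^ (1 + ρ)) ^ 2 * (lam * a) ^ (1 - 2 * ρ)) = a ^ (1 - 2 * ρ) := by
  rw [Real.mul_rpow hlam.le ha, ← Real.rpow_natCast (lam ^ (1 + ρ)) 2, ← Real.rpow_mul hlam.le,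
    ← Real.rpow_natCast lam 3, ← Real.rpow_neg hlam.le]
  push_cast
  calc lam ^ (-(3 : ℝ)) * (lam ^ ((1 + ρ) * 2) * (lam ^ (1 - 2 * ρ) * a ^ (1 - 2 * ρ)))
      = lam ^ (-(3 : ℝ) + (1 + ρ) * 2 + (1 - 2 * ρ)) * a ^ (1 - 2 * ρ) := by
        rw [Real.rpow_add hlam, Real.rpow_add hlam]; ring
    _ = a ^ (1 - 2 * ρ) := by
        rw [show -(3 : ℝ) + (1 + ρ) * 2 + (1 - 2 * ρ) = 0 by ring, Real.rpow_zero, one_mul]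

/-- Scaling constant of the dissipation: `(λ^{2+ρ} λ³)⁻¹ (λ^{1+ρ} λ)² (λa)^{1−ρ} = a^{1−ρ}`. [folklore] -/
theorem zoomConst_grad (hlam : 0 < lam) (ha : 0 ≤ a) (ρ : ℝ) :
    (lam ^ (2 + ρ) * lam ^ 3)⁻¹ * (((lam ^ (1 + ρ) * lam) ^ 2) * (lam * a) ^ (1 - ρ)) = a ^ (1 - ρ) := by
  rw [Real.mul_rpow hlam.le ha, ← rpow_two_add_eq hlam ρ, ← Real.rpow_natCast (lam ^ (2 + ρ)) 2,
    ← Real.rpow_mul hlam.le, ← Real.rpow_natCast lam 3, ← Real.rpow_add hlam, ← Real.rpow_neg hlam.le]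
  push_cast
  calc lam ^ (-(2 + ρ + 3)) * (lam ^ ((2 + ρ) * 2) * (lam ^ (1 - ρ) * a ^ (1 - ρ)))
      = lam ^ (-(2 + ρ + 3) + (2 + ρ) * 2 + (1 - ρ)) * a ^ (1 - ρ) := by
        rw [Real.rpow_add hlam, Real.rpow_add hlam]; ring
    _ = a ^ (1 - ρ) := by
        rw [show -(2 + ρ + 3) + (2 + ρ) * 2 + (1 - ρ) = (0 : ℝ) by ring, Real.rpow_zero, one_mul]

/-- Scaling constant of the pressure: `(λ^{2+ρ} λ³)⁻¹ (λ^{1+ρ})³ (λa)^{2−2ρ} = a^{2−2ρ}`. [folklore] -/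
theorem zoomConst_pressure (hlam : 0 < lam) (ha : 0 ≤ a) (ρ : ℝ) :
    (lam ^ (2 + ρ) * lam ^ 3)⁻¹ * ((lam ^ (1 + ρ)) ^ 3 * (lam * a) ^ (2 - 2 * ρ)) = a ^ (2 - 2 * ρ) := by
  rw [Real.mul_rpow hlam.le ha, ← Real.rpow_natCast (lam ^ (1 + ρ)) 3, ← Real.rpow_mul hlam.le,
    ← Real.rpow_natCast lam 3, ← Real.rpow_add hlam, ← Real.rpow_neg hlam.le]
  push_cast
  calc lam ^ (-(2 + ρ + 3)) * (lam ^ ((1 + ρ) * 3) * (lam ^ (2 - 2 * ρ) * a ^ (2 - 2 * ρ)))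
      = lam ^ (-(2 + ρ + 3) + (1 + ρ) * 3 + (2 - 2 * ρ)) * a ^ (2 - 2 * ρ) := by
        rw [Real.rpow_add hlam, Real.rpow_add hlam]; ring
    _ = a ^ (2 - 2 * ρ) := by
        rw [show -(2 + ρ + 3) + (1 + ρ) * 3 + (2 - 2 * ρ) = (0 : ℝ) by ring, Real.rpow_zero, one_mul]

/-- Scaling constant of the cubic floor: `(λ^{2+ρ} λ³)⁻¹ (λ^{1+ρ})³ = λ^{2ρ−2}`. [folklore] -/
theorem zoomConst_cube (hlam : 0 < lam) (ρ : ℝ) :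
    (lam ^ (2 + ρ) * lam ^ 3)⁻¹ * (lam ^ (1 + ρ)) ^ 3 = lam ^ (2 * ρ - 2) := by
  rw [← Real.rpow_natCast (lam ^ (1 + ρ)) 3, ← Real.rpow_mul hlam.le, ← Real.rpow_natCast lam 3,
    ← Real.rpow_add hlam, ← Real.rpow_neg hlam.le, ← Real.rpow_add hlam]
  push_cast
  congr 1
  ring

/-- **The zoomed cylinder is the preimage of the Euler window**: for `Φ(s,y) = (λ^{2+ρ}s, λy)`,
`Φ⁻¹(]−λ^{2+ρ}a², 0[ × B(0, λa)) = Q(0, a)`. [folklore] -/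
theorem stAffine_preimage_eulerWindow (hlam : 0 < lam) (ρ a : ℝ) :
    stAffine (lam ^ (2 + ρ)) lam 0 (0 : EuclideanSpace ℝ (Fin 3)) ⁻¹'
        (Ioo (-(lam ^ (2 + ρ) * a ^ 2)) 0 ×ˢ ball (0 : EuclideanSpace ℝ (Fin 3)) (lam * a)) =
      parabolicCylinder a (0 : ℝ × EuclideanSpace ℝ (Fin 3)) := by
  have hβ : 0 < lam ^ (2 + ρ) := Real.rpow_pos_of_pos hlam _
  rw [stAffine_preimage_cylinder hβ hlam, SuitableCompactness.parabolicCylinder_zero]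
  have e1 : (-(lam ^ (2 + ρ) * a ^ 2) - 0) / lam ^ (2 + ρ) = -a ^ 2 := by
    rw [sub_zero, neg_div, mul_div_cancel_left₀ _ hβ.ne']
  have e2 : ((0 : ℝ) - 0) / lam ^ (2 + ρ) = 0 := by simp
  have e3 : lam⁻¹ • ((0 : EuclideanSpace ℝ (Fin 3)) - 0) = 0 := by simp
  have e4 : lam * a / lam = a := mul_div_cancel_left₀ a hlam.ne'
  rw [e1, e2, e3, e4]

/-- The Euler window at scale `λa` lies in the parabolic cylinder `Q(0, λa)` (`λ^ρ ≤ 1`). [folklore] -/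
theorem eulerWindow_subset_parabolicCylinder (hρ : 0 ≤ ρ) (hlam : 0 < lam) (hlam1 : lam ≤ 1) (a : ℝ) :
    Ioo (-(lam ^ (2 + ρ) * a ^ 2)) 0 ×ˢ ball (0 : EuclideanSpace ℝ (Fin 3)) (lam * a) ⊆
      parabolicCylinder (lam * a) (0 : ℝ × EuclideanSpace ℝ (Fin 3)) := by
  rw [SuitableCompactness.parabolicCylinder_zero]
  refine prod_mono (Ioo_subset_Ioo ?_ le_rfl) Subset.rfl
  have h1 : lam ^ (2 + ρ) ≤ lam ^ 2 := by
    have h := Real.rpow_le_rpow_of_exponent_ge hlam hlam1 (by linarith : (2 : ℝ) ≤ 2 + ρ)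
    rwa [Real.rpow_two] at h
  have h3 : 0 ≤ a ^ 2 := sq_nonneg a
  have h4 : (lam * a) ^ 2 = lam ^ 2 * a ^ 2 := by ring
  rw [h4]
  nlinarith [mul_le_mul_of_nonneg_right h1 h3]

/-- The zoomed cylinder `Q(0,a)`, `λa ≤ 1`, lies in the preimage of the unit cylinder. [folklore] -/
theorem parabolicCylinderOpens_le_stPreimage (hρ : 0 ≤ ρ) (hlam : 0 < lam) (hlam1 : lam ≤ 1) (ha : 0 < a)
    (hla : lam * a ≤ 1) :
    parabolicCylinderOpens a (0 : ℝ × EuclideanSpace ℝ (Fin 3)) ≤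
      stPreimage (lam ^ (2 + ρ)) lam 0 (0 : EuclideanSpace ℝ (Fin 3))
        (parabolicCylinderOpens 1 (0 : ℝ × EuclideanSpace ℝ (Fin 3))) := by
  intro z hz
  rw [mem_stPreimage]
  have hz' : z ∈ parabolicCylinder a (0 : ℝ × EuclideanSpace ℝ (Fin 3)) := hz
  rw [← stAffine_preimage_eulerWindow hlam ρ a, mem_preimage] at hz'
  have h1 := eulerWindow_subset_parabolicCylinder hρ hlam hlam1 a hz'
  exact SuitableCompactness.parabolicCylinder_zero_mono (by positivity) hla h1

/-- **The Euler zoom of a suitable weak solution in `Q(0,1)` is a suitable weak solution with viscosity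
`λ^ρ` on `Q(0,a)`** (`0 < λ ≤ 1`, `λa ≤ 1`, no force). [cite: Seregin2023, §2 (p. 7)] -/
theorem eulerZoom_isSuitableWeakSolutionOn (hρ : 0 ≤ ρ) (hlam : 0 < lam) (hlam1 : lam ≤ 1) (ha : 0 < a)
    (hla : lam * a ≤ 1) {v : ℝ → EuclideanSpace ℝ (Fin 3) → EuclideanSpace ℝ (Fin 3)}
    {q : ℝ → EuclideanSpace ℝ (Fin 3) → ℝ}
    (hsw : IsSuitableWeakSolutionOn (parabolicCylinderOpens 1 (0 : ℝ × EuclideanSpace ℝ (Fin 3))) 1 0 v q) :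
    IsSuitableWeakSolutionOn (parabolicCylinderOpens a (0 : ℝ × EuclideanSpace ℝ (Fin 3))) (lam ^ ρ) 0
      ((lam ^ (1 + ρ)) • stPull (lam ^ (2 + ρ)) lam 0 (0 : EuclideanSpace ℝ (Fin 3)) v)
      ((lam ^ (1 + ρ)) ^ 2 • stPull (lam ^ (2 + ρ)) lam 0 (0 : EuclideanSpace ℝ (Fin 3)) q) := by
  have hα : 0 < lam ^ (1 + ρ) := Real.rpow_pos_of_pos hlam _
  have h := hsw.stRescale hα hlam (rpow_two_add_eq hlam ρ) 0 (0 : EuclideanSpace ℝ (Fin 3))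
  have hν : lam ^ (1 + ρ) * 1 / lam = lam ^ ρ := by
    rw [mul_one, div_eq_iff hlam.ne', Real.rpow_add hlam, Real.rpow_one, mul_comm]
  have hf : ((lam ^ (1 + ρ)) ^ 2 * lam) • stPull (lam ^ (2 + ρ)) lam 0 (0 : EuclideanSpace ℝ (Fin 3))
      (0 : ℝ → EuclideanSpace ℝ (Fin 3) → EuclideanSpace ℝ (Fin 3)) = 0 := by
    funext s y; simp [stPull]
  rw [hν, hf] at h
  exact h.of_le (parabolicCylinderOpens_le_stPreimage hρ hlam hlam1 ha hla)

/-- **The Euler zoom of the weak gradient** on `Q(0,a)`, `λa ≤ 1`. [folklore] -/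
theorem eulerZoom_hasWeakSpatialGradientOn (hρ : 0 ≤ ρ) (hlam : 0 < lam) (hlam1 : lam ≤ 1) (ha : 0 < a)
    (hla : lam * a ≤ 1) {v : ℝ → EuclideanSpace ℝ (Fin 3) → EuclideanSpace ℝ (Fin 3)}
    {G : ℝ → EuclideanSpace ℝ (Fin 3) → EuclideanSpace ℝ (Fin 3) →L[ℝ] EuclideanSpace ℝ (Fin 3)}
    (hG : HasWeakSpatialGradientOn (parabolicCylinderOpens 1 (0 : ℝ × EuclideanSpace ℝ (Fin 3))) v G) :
    HasWeakSpatialGradientOn (parabolicCylinderOpens a (0 : ℝ × EuclideanSpace ℝ (Fin 3)))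
      ((lam ^ (1 + ρ)) • stPull (lam ^ (2 + ρ)) lam 0 (0 : EuclideanSpace ℝ (Fin 3)) v)
      ((lam ^ (1 + ρ) * lam) • stPull (lam ^ (2 + ρ)) lam 0 (0 : EuclideanSpace ℝ (Fin 3)) G) :=
  (hG.stRescale (lam ^ (1 + ρ)) (Real.rpow_pos_of_pos hlam _) hlam 0 0).mono
    (parabolicCylinderOpens_le_stPreimage hρ hlam hlam1 ha hla)

/-- The three gauged quantities at radius `r ∈ ]0,1]`, unnormalised: `∫_{B_r}|v(t)|² ≤ r^{1−2ρ} M` for every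
`t ∈ ]−r²,0[`, `∫_{Q(r)} |G|² ≤ r^{1−ρ} M`, `∫_{Q(r)} |q|^{3/2} ≤ r^{2−2ρ} M`. [folklore] -/
theorem unnormalised_bounds_of_gauge {r : ℝ} (hr : 0 < r)
    {v : ℝ → EuclideanSpace ℝ (Fin 3) → EuclideanSpace ℝ (Fin 3)} {q : ℝ → EuclideanSpace ℝ (Fin 3) → ℝ}
    {G : ℝ → EuclideanSpace ℝ (Fin 3) → EuclideanSpace ℝ (Fin 3) →L[ℝ] EuclideanSpace ℝ (Fin 3)} {M : ℝ≥0}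
    (hM : ENNReal.ofReal (r ^ (2 * ρ)) * cknA r (0 : ℝ × EuclideanSpace ℝ (Fin 3)) v +
        ENNReal.ofReal (r ^ ρ) * cknE r (0 : ℝ × EuclideanSpace ℝ (Fin 3)) G +
        ENNReal.ofReal (r ^ (2 * ρ)) * cknD r (0 : ℝ × EuclideanSpace ℝ (Fin 3)) q ≤ (M : ℝ≥0∞)) :
    (∀ t ∈ Ioo (-r ^ 2) 0, ∫⁻ x in ball (0 : EuclideanSpace ℝ (Fin 3)) r, ‖v t x‖ₑ ^ 2 ≤
        ENNReal.ofReal (r ^ (1 - 2 * ρ)) * M) ∧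
      ∫⁻ z in parabolicCylinder r (0 : ℝ × EuclideanSpace ℝ (Fin 3)), ENNReal.ofReal (frobeniusNormSq (G z.1 z.2)) ≤
        ENNReal.ofReal (r ^ (1 - ρ)) * M ∧
      ∫⁻ z in parabolicCylinder r (0 : ℝ × EuclideanSpace ℝ (Fin 3)), ‖q z.1 z.2‖ₑ ^ (3 / 2 : ℝ) ≤
        ENNReal.ofReal (r ^ (2 - 2 * ρ)) * M := by
  have hA : ENNReal.ofReal (r ^ (2 * ρ)) * cknA r (0 : ℝ × EuclideanSpace ℝ (Fin 3)) v ≤ M :=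
    le_trans (le_trans le_self_add le_self_add) hM
  have hE : ENNReal.ofReal (r ^ ρ) * cknE r (0 : ℝ × EuclideanSpace ℝ (Fin 3)) G ≤ M :=
    le_trans (le_trans le_add_self le_self_add) hM
  have hD : ENNReal.ofReal (r ^ (2 * ρ)) * cknD r (0 : ℝ × EuclideanSpace ℝ (Fin 3)) q ≤ M :=
    le_trans le_add_self hM
  -- `w · X ≤ M` with `w = ofReal (r^e) > 0` gives `X ≤ ofReal (r^{-e}) M`
  have key : ∀ (e : ℝ) (X : ℝ≥0∞), ENNReal.ofReal (r ^ e) * X ≤ M → X ≤ ENNReal.ofReal (r ^ (-e)) * M := by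
    intro e X h
    have hw0 : ENNReal.ofReal (r ^ e) ≠ 0 := (ENNReal.ofReal_pos.2 (Real.rpow_pos_of_pos hr _)).ne'
    have hinv : ENNReal.ofReal (r ^ (-e)) = (ENNReal.ofReal (r ^ e))⁻¹ := by
      rw [Real.rpow_neg hr.le, ENNReal.ofReal_inv_of_pos (Real.rpow_pos_of_pos hr _)]
    rw [hinv, ← ENNReal.div_eq_inv_mul, ENNReal.le_div_iff_mul_le (Or.inl hw0) (Or.inl ENNReal.ofReal_ne_top),
      mul_comm]
    exact h
  have hr0 : ENNReal.ofReal r ≠ 0 := (ENNReal.ofReal_pos.2 hr).ne'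
  have hrT : ENNReal.ofReal r ≠ ⊤ := ENNReal.ofReal_ne_top
  -- combine `ofReal r^k * ofReal (r^{-e}) = ofReal (r^{k-e})`
  have hcomb : ∀ (k : ℕ) (e : ℝ), ENNReal.ofReal r ^ k * ENNReal.ofReal (r ^ (-e)) =
      ENNReal.ofReal (r ^ ((k : ℝ) - e)) := by
    intro k e
    rw [← ENNReal.ofReal_pow hr.le, ← ENNReal.ofReal_mul (pow_nonneg hr.le _), ← Real.rpow_natCast,
      ← Real.rpow_add hr]
    ring_nf
  refine ⟨fun t ht => ?_, ?_, ?_⟩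
  · have h1 : (ENNReal.ofReal r)⁻¹ * ∫⁻ x in ball (0 : EuclideanSpace ℝ (Fin 3)) r, ‖v t x‖ₑ ^ 2 ≤
        cknA r (0 : ℝ × EuclideanSpace ℝ (Fin 3)) v := by
      unfold cknA
      have ht' : t ∈ Ioo ((0 : ℝ × EuclideanSpace ℝ (Fin 3)).1 - r ^ 2) (0 : ℝ × EuclideanSpace ℝ (Fin 3)).1 := by
        simpa using ht
      exact le_iSup₂ (f := fun t (_ : t ∈ Ioo ((0 : ℝ × EuclideanSpace ℝ (Fin 3)).1 - r ^ 2)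
        (0 : ℝ × EuclideanSpace ℝ (Fin 3)).1) =>
        (ENNReal.ofReal r)⁻¹ * ∫⁻ x in ball (0 : ℝ × EuclideanSpace ℝ (Fin 3)).2 r, ‖v t x‖ₑ ^ 2) t ht'
    have h2 := (key _ _ hA)
    have h3 : (ENNReal.ofReal r)⁻¹ * ∫⁻ x in ball (0 : EuclideanSpace ℝ (Fin 3)) r, ‖v t x‖ₑ ^ 2 ≤
        ENNReal.ofReal (r ^ (-(2 * ρ))) * M := h1.trans h2
    rw [ENNReal.inv_mul_le_iff hr0 hrT, ← mul_assoc, ← pow_one (ENNReal.ofReal r), hcomb] at h3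
    simpa [show ((1 : ℕ) : ℝ) - 2 * ρ = 1 - 2 * ρ by norm_num] using h3
  · have h2 := key _ _ hE
    unfold cknE at h2
    rw [ENNReal.inv_mul_le_iff hr0 hrT, ← mul_assoc, ← pow_one (ENNReal.ofReal r), hcomb] at h2
    simpa [show ((1 : ℕ) : ℝ) - ρ = 1 - ρ by norm_num] using h2
  · have h2 := key _ _ hD
    unfold cknD at h2
    have hr20 : ENNReal.ofReal r ^ 2 ≠ 0 := pow_ne_zero _ hr0
    have hr2T : ENNReal.ofReal r ^ 2 ≠ ⊤ := ENNReal.pow_ne_top hrT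
    rw [ENNReal.inv_mul_le_iff hr20 hr2T, ← mul_assoc, hcomb] at h2
    simpa [show ((2 : ℕ) : ℝ) - 2 * ρ = 2 - 2 * ρ by norm_num] using h2

/-- **Uniform slice energy bound of the Euler zoom**: `∫_{B(0,a)} |v_λ(t)|² ≤ a^{1−2ρ} M` for every
`t ∈ ]−a², 0[`, `0 < λ ≤ 1`, `λa ≤ 1`. [cite: Seregin2023, §2 (2.4) (p. 7)] -/
theorem eulerZoom_slice_energy_le (hρ : 0 ≤ ρ) (hlam : 0 < lam) (hlam1 : lam ≤ 1) (ha : 0 < a)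
    (hla : lam * a ≤ 1)
    {v : ℝ → EuclideanSpace ℝ (Fin 3) → EuclideanSpace ℝ (Fin 3)} {q : ℝ → EuclideanSpace ℝ (Fin 3) → ℝ}
    {G : ℝ → EuclideanSpace ℝ (Fin 3) → EuclideanSpace ℝ (Fin 3) →L[ℝ] EuclideanSpace ℝ (Fin 3)} {M : ℝ≥0}
    (hM : ∀ r ∈ Ioc (0 : ℝ) 1,
      ENNReal.ofReal (r ^ (2 * ρ)) * cknA r (0 : ℝ × EuclideanSpace ℝ (Fin 3)) v +
          ENNReal.ofReal (r ^ ρ) * cknE r (0 : ℝ × EuclideanSpace ℝ (Fin 3)) G +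
          ENNReal.ofReal (r ^ (2 * ρ)) * cknD r (0 : ℝ × EuclideanSpace ℝ (Fin 3)) q ≤ (M : ℝ≥0∞))
    {t : ℝ} (ht : t ∈ Ioo (-a ^ 2) 0) :
    ∫⁻ x in ball (0 : EuclideanSpace ℝ (Fin 3)) a,
        ‖((lam ^ (1 + ρ)) • stPull (lam ^ (2 + ρ)) lam 0 (0 : EuclideanSpace ℝ (Fin 3)) v) t x‖ₑ ^ 2 ≤
      ENNReal.ofReal (a ^ (1 - 2 * ρ)) * M := by
  have hα : 0 < lam ^ (1 + ρ) := Real.rpow_pos_of_pos hlam _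
  have hβ : 0 < lam ^ (2 + ρ) := Real.rpow_pos_of_pos hlam _
  have hla0 : 0 < lam * a := mul_pos hlam ha
  obtain ⟨hAb, -, -⟩ := unnormalised_bounds_of_gauge (ρ := ρ) hla0 (hM (lam * a) ⟨hla0, hla⟩)
  -- the zoomed time lies in the window of radius `λa`
  have htβ : lam ^ (2 + ρ) * t ∈ Ioo (-(lam * a) ^ 2) 0 := by
    refine ⟨?_, mul_neg_of_pos_of_neg hβ ht.2⟩
    have h1 : lam ^ (2 + ρ) ≤ lam ^ 2 := by
      have h := Real.rpow_le_rpow_of_exponent_ge hlam hlam1 (by linarith : (2 : ℝ) ≤ 2 + ρ)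
      rwa [Real.rpow_two] at h
    have e1 : lam ^ 2 * (-a ^ 2) < lam ^ 2 * t := mul_lt_mul_of_pos_left ht.1 (pow_pos hlam 2)
    have e2 : lam ^ 2 * t ≤ lam ^ (2 + ρ) * t := mul_le_mul_of_nonpos_right h1 ht.2.le
    have e3 : -(lam * a) ^ 2 = lam ^ 2 * (-a ^ 2) := by ring
    rw [e3]
    exact e1.trans_le e2
  -- spatial change of variables
  have hF : (fun x : EuclideanSpace ℝ (Fin 3) =>
      ‖((lam ^ (1 + ρ)) • stPull (lam ^ (2 + ρ)) lam 0 (0 : EuclideanSpace ℝ (Fin 3)) v) t x‖ₑ ^ 2) =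
      fun x => (fun y : EuclideanSpace ℝ (Fin 3) => ENNReal.ofReal (lam ^ (1 + ρ)) ^ 2 *
        ‖v (lam ^ (2 + ρ) * t) y‖ₑ ^ 2) ((0 : EuclideanSpace ℝ (Fin 3)) + lam • x) := by
    funext x
    simp only [smul_stPull_apply, zero_add, enorm_smul, mul_pow, Real.enorm_eq_ofReal hα.le]
  have hpre : (fun y : EuclideanSpace ℝ (Fin 3) => (0 : EuclideanSpace ℝ (Fin 3)) + lam • y) ⁻¹'
      ball (0 : EuclideanSpace ℝ (Fin 3)) (lam * a) = ball (0 : EuclideanSpace ℝ (Fin 3)) a := by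
    rw [space_affine_preimage_ball hlam]
    simp [mul_div_cancel_left₀ a hlam.ne']
  rw [hF, ← hpre, setLIntegral_preimage_comp_space_affine (E := EuclideanSpace ℝ (Fin 3)) hlam 0
    (fun y : EuclideanSpace ℝ (Fin 3) => ENNReal.ofReal (lam ^ (1 + ρ)) ^ 2 * ‖v (lam ^ (2 + ρ) * t) y‖ₑ ^ 2)
    (ball (0 : EuclideanSpace ℝ (Fin 3)) (lam * a)), finrank_euclideanSpace_fin,
    lintegral_const_mul' _ _ (by simp)]
  calc ENNReal.ofReal (lam ^ 3)⁻¹ * (ENNReal.ofReal (lam ^ (1 + ρ)) ^ 2 *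
        ∫⁻ y in ball (0 : EuclideanSpace ℝ (Fin 3)) (lam * a), ‖v (lam ^ (2 + ρ) * t) y‖ₑ ^ 2)
      ≤ ENNReal.ofReal (lam ^ 3)⁻¹ * (ENNReal.ofReal (lam ^ (1 + ρ)) ^ 2 *
          (ENNReal.ofReal ((lam * a) ^ (1 - 2 * ρ)) * M)) := by
        gcongr
        exact hAb _ htβ
    _ = ENNReal.ofReal ((lam ^ 3)⁻¹ * ((lam ^ (1 + ρ)) ^ 2 * (lam * a) ^ (1 - 2 * ρ))) * M := by
        rw [← ENNReal.ofReal_pow hα.le, ENNReal.ofReal_mul (by positivity), ENNReal.ofReal_mul (by positivity)]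
        ring
    _ = ENNReal.ofReal (a ^ (1 - 2 * ρ)) * M := by rw [zoomConst_energy hlam ha.le ρ]

/-- Space–time change of variables for the Euler zoom on `Q(0,a)`:
`∫_{Q(0,a)} F(Φ z) = (λ^{2+ρ} λ³)⁻¹ ∫_{]−λ^{2+ρ}a²,0[ × B(0,λa)} F`. [folklore] -/
theorem setLIntegral_parabolicCylinder_comp_eulerZoom (hlam : 0 < lam) (ρ a : ℝ)
    (F : ℝ × EuclideanSpace ℝ (Fin 3) → ℝ≥0∞) :
    ∫⁻ z in parabolicCylinder a (0 : ℝ × EuclideanSpace ℝ (Fin 3)),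
        F (stAffine (lam ^ (2 + ρ)) lam 0 (0 : EuclideanSpace ℝ (Fin 3)) z) =
      ENNReal.ofReal (lam ^ (2 + ρ) * lam ^ 3)⁻¹ *
        ∫⁻ z in Ioo (-(lam ^ (2 + ρ) * a ^ 2)) 0 ×ˢ ball (0 : EuclideanSpace ℝ (Fin 3)) (lam * a), F z := by
  rw [← stAffine_preimage_eulerWindow hlam ρ a,
    setLIntegral_preimage_comp_stAffine (E := EuclideanSpace ℝ (Fin 3)) (Real.rpow_pos_of_pos hlam _) hlam 0 0 F,
    finrank_euclideanSpace_fin]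

/-- **Uniform gradient bound of the Euler zoom**: `∫_{Q(0,a)} |G_λ|² ≤ a^{1−ρ} M` (`0 < λ ≤ 1`, `λa ≤ 1`).
[cite: Seregin2023, §2 (2.4) (p. 7)] -/
theorem eulerZoom_grad_le (hρ : 0 ≤ ρ) (hlam : 0 < lam) (hlam1 : lam ≤ 1) (ha : 0 < a) (hla : lam * a ≤ 1)
    {v : ℝ → EuclideanSpace ℝ (Fin 3) → EuclideanSpace ℝ (Fin 3)} {q : ℝ → EuclideanSpace ℝ (Fin 3) → ℝ}
    {G : ℝ → EuclideanSpace ℝ (Fin 3) → EuclideanSpace ℝ (Fin 3) →L[ℝ] EuclideanSpace ℝ (Fin 3)} {M : ℝ≥0}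
    (hM : ∀ r ∈ Ioc (0 : ℝ) 1,
      ENNReal.ofReal (r ^ (2 * ρ)) * cknA r (0 : ℝ × EuclideanSpace ℝ (Fin 3)) v +
          ENNReal.ofReal (r ^ ρ) * cknE r (0 : ℝ × EuclideanSpace ℝ (Fin 3)) G +
          ENNReal.ofReal (r ^ (2 * ρ)) * cknD r (0 : ℝ × EuclideanSpace ℝ (Fin 3)) q ≤ (M : ℝ≥0∞)) :
    ∫⁻ z in parabolicCylinder a (0 : ℝ × EuclideanSpace ℝ (Fin 3)),
        ENNReal.ofReal (frobeniusNormSq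
          (((lam ^ (1 + ρ) * lam) • stPull (lam ^ (2 + ρ)) lam 0 (0 : EuclideanSpace ℝ (Fin 3)) G) z.1 z.2)) ≤
      ENNReal.ofReal (a ^ (1 - ρ)) * M := by
  have hla0 : 0 < lam * a := mul_pos hlam ha
  obtain ⟨-, hEb, -⟩ := unnormalised_bounds_of_gauge (ρ := ρ) hla0 (hM (lam * a) ⟨hla0, hla⟩)
  have hF : (fun z : ℝ × EuclideanSpace ℝ (Fin 3) => ENNReal.ofReal (frobeniusNormSq
      (((lam ^ (1 + ρ) * lam) • stPull (lam ^ (2 + ρ)) lam 0 (0 : EuclideanSpace ℝ (Fin 3)) G) z.1 z.2))) =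
      fun z => (fun w : ℝ × EuclideanSpace ℝ (Fin 3) => ENNReal.ofReal ((lam ^ (1 + ρ) * lam) ^ 2) *
        ENNReal.ofReal (frobeniusNormSq (G w.1 w.2)))
          (stAffine (lam ^ (2 + ρ)) lam 0 (0 : EuclideanSpace ℝ (Fin 3)) z) := by
    funext z
    simp only [Pi.smul_apply, stPull_apply, stAffine_fst, stAffine_snd, frobeniusNormSq_smul, zero_add]
    rw [ENNReal.ofReal_mul (sq_nonneg _)]
  rw [hF, setLIntegral_parabolicCylinder_comp_eulerZoom hlam ρ a
    (fun w : ℝ × EuclideanSpace ℝ (Fin 3) => ENNReal.ofReal ((lam ^ (1 + ρ) * lam) ^ 2) *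
      ENNReal.ofReal (frobeniusNormSq (G w.1 w.2))), lintegral_const_mul' _ _ ENNReal.ofReal_ne_top]
  calc ENNReal.ofReal (lam ^ (2 + ρ) * lam ^ 3)⁻¹ * (ENNReal.ofReal ((lam ^ (1 + ρ) * lam) ^ 2) *
        ∫⁻ z in Ioo (-(lam ^ (2 + ρ) * a ^ 2)) 0 ×ˢ ball (0 : EuclideanSpace ℝ (Fin 3)) (lam * a),
          ENNReal.ofReal (frobeniusNormSq (G z.1 z.2)))
      ≤ ENNReal.ofReal (lam ^ (2 + ρ) * lam ^ 3)⁻¹ * (ENNReal.ofReal ((lam ^ (1 + ρ) * lam) ^ 2) *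
          (ENNReal.ofReal ((lam * a) ^ (1 - ρ)) * M)) := by
        gcongr
        exact (lintegral_mono_set (eulerWindow_subset_parabolicCylinder hρ hlam hlam1 a)).trans hEb
    _ = ENNReal.ofReal ((lam ^ (2 + ρ) * lam ^ 3)⁻¹ * (((lam ^ (1 + ρ) * lam) ^ 2) * (lam * a) ^ (1 - ρ))) * M := by
        rw [ENNReal.ofReal_mul (by positivity), ENNReal.ofReal_mul (by positivity)]
        ring
    _ = ENNReal.ofReal (a ^ (1 - ρ)) * M := by rw [zoomConst_grad hlam ha.le ρ]

/-- **Uniform pressure bound of the Euler zoom**: `∫_{Q(0,a)} |q_λ|^{3/2} ≤ a^{2−2ρ} M` (`0 < λ ≤ 1`, `λa ≤ 1`).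
[cite: Seregin2023, §2 (2.4) (p. 7)] -/
theorem eulerZoom_pressure_le (hρ : 0 ≤ ρ) (hlam : 0 < lam) (hlam1 : lam ≤ 1) (ha : 0 < a) (hla : lam * a ≤ 1)
    {v : ℝ → EuclideanSpace ℝ (Fin 3) → EuclideanSpace ℝ (Fin 3)} {q : ℝ → EuclideanSpace ℝ (Fin 3) → ℝ}
    {G : ℝ → EuclideanSpace ℝ (Fin 3) → EuclideanSpace ℝ (Fin 3) →L[ℝ] EuclideanSpace ℝ (Fin 3)} {M : ℝ≥0}
    (hM : ∀ r ∈ Ioc (0 : ℝ) 1,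
      ENNReal.ofReal (r ^ (2 * ρ)) * cknA r (0 : ℝ × EuclideanSpace ℝ (Fin 3)) v +
          ENNReal.ofReal (r ^ ρ) * cknE r (0 : ℝ × EuclideanSpace ℝ (Fin 3)) G +
          ENNReal.ofReal (r ^ (2 * ρ)) * cknD r (0 : ℝ × EuclideanSpace ℝ (Fin 3)) q ≤ (M : ℝ≥0∞)) :
    ∫⁻ z in parabolicCylinder a (0 : ℝ × EuclideanSpace ℝ (Fin 3)),
        ‖((lam ^ (1 + ρ)) ^ 2 • stPull (lam ^ (2 + ρ)) lam 0 (0 : EuclideanSpace ℝ (Fin 3)) q) z.1 z.2‖ₑ ^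
          (3 / 2 : ℝ) ≤
      ENNReal.ofReal (a ^ (2 - 2 * ρ)) * M := by
  have hα : 0 < lam ^ (1 + ρ) := Real.rpow_pos_of_pos hlam _
  have hla0 : 0 < lam * a := mul_pos hlam ha
  obtain ⟨-, -, hDb⟩ := unnormalised_bounds_of_gauge (ρ := ρ) hla0 (hM (lam * a) ⟨hla0, hla⟩)
  have hF : (fun z : ℝ × EuclideanSpace ℝ (Fin 3) =>
      ‖((lam ^ (1 + ρ)) ^ 2 • stPull (lam ^ (2 + ρ)) lam 0 (0 : EuclideanSpace ℝ (Fin 3)) q) z.1 z.2‖ₑ ^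
        (3 / 2 : ℝ)) =
      fun z => (fun w : ℝ × EuclideanSpace ℝ (Fin 3) => ENNReal.ofReal ((lam ^ (1 + ρ)) ^ 2) ^ (3 / 2 : ℝ) *
        ‖q w.1 w.2‖ₑ ^ (3 / 2 : ℝ)) (stAffine (lam ^ (2 + ρ)) lam 0 (0 : EuclideanSpace ℝ (Fin 3)) z) := by
    funext z
    simp only [smul_stPull_apply, stAffine_fst, stAffine_snd, zero_add, smul_eq_mul, enorm_mul,
      Real.enorm_eq_ofReal (sq_nonneg _)]
    rw [ENNReal.mul_rpow_of_nonneg _ _ (by norm_num)]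
  have hc3 : ENNReal.ofReal ((lam ^ (1 + ρ)) ^ 2) ^ (3 / 2 : ℝ) = ENNReal.ofReal ((lam ^ (1 + ρ)) ^ 3) := by
    rw [ENNReal.ofReal_rpow_of_nonneg (sq_nonneg _) (by norm_num), ← Real.rpow_natCast (lam ^ (1 + ρ)) 2,
      ← Real.rpow_mul hα.le, ← Real.rpow_natCast (lam ^ (1 + ρ)) 3]
    norm_num
  rw [hF, setLIntegral_parabolicCylinder_comp_eulerZoom hlam ρ a
    (fun w : ℝ × EuclideanSpace ℝ (Fin 3) => ENNReal.ofReal ((lam ^ (1 + ρ)) ^ 2) ^ (3 / 2 : ℝ) *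
      ‖q w.1 w.2‖ₑ ^ (3 / 2 : ℝ)),
    lintegral_const_mul' _ _ (ENNReal.rpow_ne_top_of_nonneg (by norm_num) ENNReal.ofReal_ne_top), hc3]
  calc ENNReal.ofReal (lam ^ (2 + ρ) * lam ^ 3)⁻¹ * (ENNReal.ofReal ((lam ^ (1 + ρ)) ^ 3) *
        ∫⁻ z in Ioo (-(lam ^ (2 + ρ) * a ^ 2)) 0 ×ˢ ball (0 : EuclideanSpace ℝ (Fin 3)) (lam * a),
          ‖q z.1 z.2‖ₑ ^ (3 / 2 : ℝ))
      ≤ ENNReal.ofReal (lam ^ (2 + ρ) * lam ^ 3)⁻¹ * (ENNReal.ofReal ((lam ^ (1 + ρ)) ^ 3) *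
          (ENNReal.ofReal ((lam * a) ^ (2 - 2 * ρ)) * M)) := by
        gcongr
        exact (lintegral_mono_set (eulerWindow_subset_parabolicCylinder hρ hlam hlam1 a)).trans hDb
    _ = ENNReal.ofReal ((lam ^ (2 + ρ) * lam ^ 3)⁻¹ * ((lam ^ (1 + ρ)) ^ 3 * (lam * a) ^ (2 - 2 * ρ))) * M := by
        rw [ENNReal.ofReal_mul (by positivity), ENNReal.ofReal_mul (by positivity)]
        ring
    _ = ENNReal.ofReal (a ^ (2 - 2 * ρ)) * M := by rw [zoomConst_pressure hlam ha.le ρ]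

/-- **The floor quantity under the Euler zoom**: `∫_{Q(0,1)} |v_λ|³ = λ^{2ρ−2} ∫_{]−λ^{2+ρ},0[ × B(0,λ)} |v|³`
(`λ > 0`). [cite: Seregin2026, (3.1) (p. 8)] -/
theorem eulerZoom_cube_eq (hlam : 0 < lam) (ρ : ℝ)
    (v : ℝ → EuclideanSpace ℝ (Fin 3) → EuclideanSpace ℝ (Fin 3)) :
    ∫⁻ z in parabolicCylinder 1 (0 : ℝ × EuclideanSpace ℝ (Fin 3)),
        ‖((lam ^ (1 + ρ)) • stPull (lam ^ (2 + ρ)) lam 0 (0 : EuclideanSpace ℝ (Fin 3)) v) z.1 z.2‖ₑ ^ (3 : ℕ) =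
      ENNReal.ofReal (lam ^ (2 * ρ - 2)) *
        ∫⁻ z in Ioo (-(lam ^ (2 + ρ))) 0 ×ˢ ball (0 : EuclideanSpace ℝ (Fin 3)) lam, ‖v z.1 z.2‖ₑ ^ (3 : ℕ) := by
  have hα : 0 < lam ^ (1 + ρ) := Real.rpow_pos_of_pos hlam _
  have hF : (fun z : ℝ × EuclideanSpace ℝ (Fin 3) =>
      ‖((lam ^ (1 + ρ)) • stPull (lam ^ (2 + ρ)) lam 0 (0 : EuclideanSpace ℝ (Fin 3)) v) z.1 z.2‖ₑ ^ (3 : ℕ)) =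
      fun z => (fun w : ℝ × EuclideanSpace ℝ (Fin 3) => ENNReal.ofReal (lam ^ (1 + ρ)) ^ (3 : ℕ) *
        ‖v w.1 w.2‖ₑ ^ (3 : ℕ)) (stAffine (lam ^ (2 + ρ)) lam 0 (0 : EuclideanSpace ℝ (Fin 3)) z) := by
    funext z
    simp only [smul_stPull_apply, stAffine_fst, stAffine_snd, zero_add, enorm_smul, mul_pow,
      Real.enorm_eq_ofReal hα.le]
  rw [hF, setLIntegral_parabolicCylinder_comp_eulerZoom hlam ρ 1
    (fun w : ℝ × EuclideanSpace ℝ (Fin 3) => ENNReal.ofReal (lam ^ (1 + ρ)) ^ (3 : ℕ) * ‖v w.1 w.2‖ₑ ^ (3 : ℕ)),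
    lintegral_const_mul' _ _ (by simp), ← mul_assoc, one_pow, mul_one, mul_one]
  congr 1
  rw [← ENNReal.ofReal_pow hα.le, ← ENNReal.ofReal_mul (by positivity), zoomConst_cube hlam ρ]

end EulerZoom

end Summit.NavierStokesRegularity.NavierStokesRegularity.Theorems.SereginZoomReduction
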